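/-
Copyright (c) 2026. All rights reserved.
Released under Apache 2.0 license as described in the file LICENSE.
Authors: abc-iut cell, campaign-S prover seat abc-iut-S7.
-/
import Literature.IUT.LogVolume.AdaptedBasis
import Literature.IUT.LogVolume.TensorPacketHaar
import HarnessLib

/-!
# The log-volume of a tensor product of lattices: `μ^log(⊗_i M_i) = Σ_i μ^log_i(M_i) + μ^log(R_I)`

Mochizuki, *Inter-universal Teichmüller theory IV* (RIMS, Apr. 2020), proof of Prop. 1.4 (iii), kurims
p. 14, second line of the final display: "`μ^log(p^{⌊λ−d_I−a_I⌋}·log_p(R_I^×)) ≤ (−λ+d_I+a_I+1)·log(p) +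
μ^log(log_p(R_I^×)) = (−λ+d_I+a_I+1)·log(p) + {Σ_{i∈I} μ^log(log_p(R_i^×))} + μ^log(R_I)`" — the
log-volume, on the tensor packet `V = ⊗_{ℚ_p} k_i` normalised at `(R_I)^∼` and by `dim V`, of the tensor
product `log_p(R_I^×) = ⊗_{ℤ_p} log_p(R_i^×)` of the `ℤ_p`-lattices `log_p(R_i^×) ⊆ k_i` is the SUM of
the normalised log-volumes of the factors plus `μ^log(R_I)`.  PROVED here for arbitrary compact open
additive subgroups `M_i ⊆ k_i` (`tensorLogVolume_packetOf`), with the intrinsic volume `tensorLogVolume`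
of `TensorPacketHaar.lean`:

* `packetOf M` — the packet `⊗_i M_i ⊆ V` (additive subgroup generated by the pure tensors
  `⊗ z_i`, `z_i ∈ M_i`); `logPacket_eq_packetOf` — S1's `log_p(R_I^×)` is the packet of the `log_p(R_i^×)`;
* `packetOf_eq_boxLattice` — in ADAPTED integral bases `M_i = ⊕_j c_{ij} ℤ_p b_{ij}` (`AdaptedBasis.lean`,
  elementary divisors), `⊗ M_i = ⊕_κ (∏_i c_{iκ_i}) ℤ_p (⊗_i b_{iκ_i})` is a BOX lattice of the tensor basis;
* `tensorLogVolume_packetOf` — hence, by the product structure of Haar measure in tensor coordinates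
  (`PadicBoxVolume.lean`) and `Σ_κ Σ_i log‖c_{iκ_i}‖ = Σ_i (dim V / n_i)·Σ_j log‖c_{ij}‖`:
  `μ^log(⊗ M_i) = Σ_i μ^log_{k_i}(M_i) + μ^log(R_I)`, where `μ^log_{k_i} = normalizedLocalLogVolume (k i) n_i`
  (`n_i = [k_i : ℚ_p]`, Haar normalised on `𝒪_{k_i}`; `LocalFieldVolume.lean`).

Classical (index of a tensor product of sublattices); nothing here is disputed.
[cite: Mochizuki2012, IUTchIV Prop. 1.4 (iii) proof p. 14]
Deliberately NOT here: the estimates of Prop. 1.4 (iii) themselves (abc-iut-S8), [IUTchIII] Cor. 3.12.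
-/

noncomputable section

open MeasureTheory Set Metric TopologicalSpace Module
open scoped NNReal ENNReal Pointwise TensorProduct NormedField
open Literature.NumberTheory.GaloisRepresentations.Ultrametric

namespace Literature.IUT.LogVolume

/-- Summing a function of one coordinate over a box of indices:
`Σ_{κ ∈ ∏_i Fin n_i} f(κ_i) · n_i = (∏_i n_i) · Σ_j f(j)`. [folklore] -/
private theorem sum_pi_apply_mul_card {I : Type} [Fintype I] [DecidableEq I] {n : I → ℕ} (i : I)
    (f : Fin (n i) → ℝ) :
    (∑ κ : Π i, Fin (n i), f (κ i)) * n i = (∏ i, (n i : ℝ)) * ∑ j, f j := by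
  classical
  let e := Equiv.piSplitAt i (fun i => Fin (n i))
  have h1 : ∑ κ : Π i, Fin (n i), f (κ i) = ∑ q : Fin (n i) × (Π j : {j // j ≠ i}, Fin (n j)), f q.1 := by
    refine Fintype.sum_equiv e _ _ fun κ => ?_
    simp [e, Equiv.piSplitAt]
  have hcard : (∏ i, (n i : ℝ)) = n i * Fintype.card (Π j : {j // j ≠ i}, Fin (n j)) := by
    have := Fintype.card_congr e
    rw [Fintype.card_pi, Fintype.card_prod, Fintype.card_fin] at this
    simp only [Fintype.card_fin] at this
    exact_mod_cast this
  rw [h1, Fintype.sum_prod_type]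
  simp only [Finset.sum_const, Finset.card_univ, nsmul_eq_mul]
  rw [hcard, ← Finset.mul_sum]
  ring

variable (p : ℕ) [Fact p.Prime]
variable {I : Type} [Fintype I] [DecidableEq I]
variable (k : I → Type) [∀ i, NontriviallyNormedField (k i)] [∀ i, NormedAlgebra ℚ_[p] (k i)]
  [∀ i, IsUltrametricDist (k i)] [∀ i, ProperSpace (k i)]

/-! ### Packets of subgroups -/

omit [Fintype I] [∀ i, IsUltrametricDist (k i)] [∀ i, ProperSpace (k i)] in
/-- **The packet `⊗_i M_i ⊆ V`** of additive subgroups `M_i ⊆ k_i`: the additive subgroup of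
`V = ⊗_{ℚ_p} k_i` generated by the pure tensors `⊗_i z_i` with `z_i ∈ M_i` (for `ℤ_p`-lattices `M_i` this is
the image of the injective map `⊗_{ℤ_p} M_i → V`; "`log_p(R_E^×) := ⊗_{i∈E} log_p(R_i^×)` … where the tensor
product is over `ℤ_p`", [IUTchIV] Prop. 1.2 p. 10). [cite: Mochizuki2012, IUTchIV Prop. 1.2 p. 10] -/
def packetOf (M : Π i, AddSubgroup (k i)) : AddSubgroup (PacketAlgebra p k) :=
  AddSubgroup.closure {t | ∃ z : Π i, k i, (∀ i, z i ∈ M i) ∧ t = purePacket p k z}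

omit [Fintype I] [DecidableEq I] [∀ i, IsUltrametricDist (k i)] [∀ i, ProperSpace (k i)] in
/-- Pure tensors of elements of the `M_i` lie in the packet. [cite: Mochizuki2012, IUTchIV Prop. 1.2 p. 10] -/
theorem purePacket_mem_packetOf (M : Π i, AddSubgroup (k i)) {z : Π i, k i} (hz : ∀ i, z i ∈ M i) :
    purePacket p k z ∈ packetOf p k M :=
  AddSubgroup.subset_closure ⟨z, hz, rfl⟩

omit [Fintype I] [DecidableEq I] in
/-- S1's `log_p(R_I^×) = logPacket` is the packet of the `log_p(R_i^×)`.
[cite: Mochizuki2012, IUTchIV Prop. 1.2 p. 10] -/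
theorem logPacket_eq_packetOf :
    logPacket p k = packetOf p k (fun i => logUnitsAddSubgroup p (k i)) := rfl

/-! ### In adapted bases the packet is a box lattice -/

omit [∀ i, IsUltrametricDist (k i)] [∀ i, ProperSpace (k i)] in
/-- **`⊗_i (⊕_j c_{ij} ℤ_p b_{ij}) = ⊕_κ (∏_i c_{iκ_i}) ℤ_p (⊗_i b_{iκ_i})`**: if each `M_i` is the box
lattice of an integral basis `b_i` with radii `c_i`, the packet `⊗ M_i` is the box lattice of the tensor
basis with the product radii. [cite: Mochizuki2012, IUTchIV Prop. 1.4 (iii) proof p. 14] -/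
theorem packetOf_eq_boxLattice [Nonempty I] {n : I → ℕ} (b : Π i, Basis (Fin (n i)) ℚ_[p] (k i))
    (c : Π i, Fin (n i) → ℚ_[p]ˣ) (M : Π i, AddSubgroup (k i))
    (hM : ∀ i (x : k i), x ∈ M i ↔ x ∈ PadicModule.boxLattice p (b i) (c i)) :
    packetOf p k M =
      PadicModule.boxLattice p (Basis.piTensorProduct b) (fun κ => ∏ i, c i (κ i)) := by
  let B : Basis (Π i, Fin (n i)) ℚ_[p] (PacketAlgebra p k) := Basis.piTensorProduct b
  apply le_antisymm
  · -- generators have coordinates `∏_i (b_i-coordinates of z_i)`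
    rw [packetOf, AddSubgroup.closure_le]
    rintro _ ⟨z, hz, rfl⟩
    rw [SetLike.mem_coe, PadicModule.mem_boxLattice]
    intro κ
    rw [purePacket, Basis.piTensorProduct_repr_tprod_apply, norm_prod, Units.coe_prod, norm_prod]
    exact Finset.prod_le_prod (fun i _ => norm_nonneg _)
      fun i _ => (PadicModule.mem_boxLattice p (b i) (c i)).mp ((hM i (z i)).mp (hz i)) (κ i)
  · -- a vector of the box is `Σ_κ d_κ • ⊗_i (c_{iκ_i} • b_i(κ_i))` with `‖d_κ‖ ≤ 1`
    intro w hw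
    obtain ⟨i₀⟩ := ‹Nonempty I›
    rw [← B.sum_repr w]
    refine AddSubgroup.sum_mem _ fun κ _ => ?_
    have hwκ : ‖B.repr w κ‖ ≤ ‖((∏ i, c i (κ i) : ℚ_[p]ˣ) : ℚ_[p])‖ :=
      (PadicModule.mem_boxLattice p B _).mp hw κ
    set C : ℚ_[p] := ((∏ i, c i (κ i) : ℚ_[p]ˣ) : ℚ_[p]) with hC
    have hC0 : C ≠ 0 := Units.ne_zero _
    set d : ℚ_[p] := B.repr w κ / C with hd
    have hd1 : ‖d‖ ≤ 1 := by rw [hd, norm_div]; exact div_le_one_of_le₀ hwκ (norm_nonneg _)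
    have hsplit : B.repr w κ • B κ = d • purePacket p k (fun i => (c i (κ i) : ℚ_[p]) • b i (κ i)) := by
      rw [purePacket, MultilinearMap.map_smul_univ, smul_smul, ← Units.coe_prod, ← hC, hd,
        div_mul_cancel₀ _ hC0]
      congr 1
      exact Basis.piTensorProduct_apply b κ
    rw [hsplit, Algebra.smul_def, PiTensorProduct.algebraMap_apply _ i₀, purePacket,
      PiTensorProduct.tprod_mul_tprod]
    refine purePacket_mem_packetOf p k M fun i => (hM i _).mpr ?_
    rcases eq_or_ne i i₀ with rfl | hne
    · rw [Pi.mul_apply, Pi.mulSingle_eq_same, ← Algebra.smul_def]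
      exact PadicModule.smul_mem_boxLattice p (b i) (c i) hd1
        (PadicModule.smul_basis_mem_boxLattice p (b i) (c i) (κ i))
    · rw [Pi.mul_apply, Pi.mulSingle_eq_of_ne hne, one_mul]
      exact PadicModule.smul_basis_mem_boxLattice p (b i) (c i) (κ i)

/-! ### The identity -/

variable [Nonempty I]

/-- Two integral structures with the same underlying set have the same Haar measure.
[cite: MochizukiAbsTopIII2015, Prop. 5.7 (i)(a) p. 137] -/
theorem haar_eq_of_coe_eq {W : Type*} [AddCommGroup W] [TopologicalSpace W] [IsTopologicalAddGroup W]
    [MeasurableSpace W] [BorelSpace W] (Λ Λ' : IntegralStructure W) (h : (Λ : Set W) = (Λ' : Set W)) :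
    Λ.haar = Λ'.haar := by
  have h1 : Λ'.haar (Λ : Set W) = 1 := by rw [h]; exact Λ'.haar_self
  rw [Λ'.haar_eq_smul_haar Λ, h1, inv_one, one_smul]

/-- **The log-volume of a tensor product of lattices.** For compact open additive subgroups `M_i ⊆ k_i`,
`μ^log(⊗_i M_i) = Σ_i μ^log_{k_i}(M_i) + μ^log(R_I)` — with `μ^log = tensorLogVolume` (Haar on `V`,
normalised at `(R_I)^∼`, divided by `dim V`) and `μ^log_{k_i} = normalizedLocalLogVolume (k i) [k_i:ℚ_p]`
(Haar on `k_i` normalised at `O_{k_i}`, divided by the degree). This is the identity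
"`μ^log(log_p(R_I^×)) = {Σ_{i∈I} μ^log(log_p(R_i^×))} + μ^log(R_I)`" of the proof of [IUTchIV] Prop. 1.4
(iii) (with `M_i = log_p(R_i^×)`, cf. `logPacket_eq_packetOf`).
[cite: Mochizuki2012, IUTchIV Prop. 1.4 (iii) proof p. 14] -/
theorem tensorLogVolume_packetOf [∀ i, MeasurableSpace (k i)] [∀ i, BorelSpace (k i)]
    (M : Π i, AddSubgroup (k i)) (hMo : ∀ i, IsOpen (M i : Set (k i)))
    (hMc : ∀ i, IsCompact (M i : Set (k i))) :
    tensorLogVolume p k (packetOf p k M) =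
      (∑ i, normalizedLocalLogVolume (k i) (finrank ℚ_[p] (k i)) (M i : Set (k i))) +
        tensorLogVolume p k (integerPacket p k) := by
  -- adapted bases in every factor
  choose n bZ b c hn hb hM using fun i => exists_adaptedBasis p (M i) (hMo i) (hMc i)
  let B : Basis (Π i, Fin (n i)) ℚ_[p] (PacketAlgebra p k) := Basis.piTensorProduct b
  have hRI : (PadicModule.basisLattice p B : Set (PacketAlgebra p k)) = integerPacket p k :=
    basisLattice_piTensorProduct_eq_integerPacket p k bZ b hb
  have hΛ : (integerStructure p k).haar = (PadicModule.basisIntegralStructure p B).haar :=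
    haar_eq_of_coe_eq _ _ (by rw [coe_integerStructure, PadicModule.coe_basisIntegralStructure, hRI])
  have hpacket : (packetOf p k M : Set (PacketAlgebra p k)) =
      PadicModule.boxLattice p B (fun κ => ∏ i, c i (κ i)) := by
    rw [packetOf_eq_boxLattice p k b c M hM]
  -- the volume of the packet in tensor coordinates
  have hvol : (integerStructure p k).logVolume (packetOf p k M : Set (PacketAlgebra p k)) =
      ∑ κ : Π i, Fin (n i), ∑ i, Real.log ‖(c i (κ i) : ℚ_[p])‖ := by
    rw [IntegralStructure.logVolume, hΛ, hpacket, ← IntegralStructure.logVolume,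
      PadicModule.logVolume_boxLattice]
    refine Finset.sum_congr rfl fun κ _ => ?_
    rw [Units.coe_prod, norm_prod, Real.log_prod]
    exact fun i _ => norm_ne_zero_iff.mpr (c i (κ i)).ne_zero
  -- the volume of each factor
  have hfac : ∀ i, localLogVolume (k i) (M i : Set (k i)) = ∑ j, Real.log ‖(c i j : ℚ_[p])‖ :=
    fun i => localLogVolume_eq_sum_log_of_adapted p (bZ i) (b i) (c i) (hb i) _ (hM i)
  -- dimension count
  have hdim : (finrank ℚ_[p] (PacketAlgebra p k) : ℝ) = ∏ i, (n i : ℝ) := by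
    rw [Module.finrank_eq_card_basis B, Fintype.card_pi]
    push_cast
    exact Finset.prod_congr rfl fun i _ => by rw [Fintype.card_fin]
  have hni : ∀ i, (finrank ℚ_[p] (k i) : ℝ) = n i := fun i => by
    rw [Module.finrank_eq_card_basis (b i), Fintype.card_fin]
  have hN0 : (∏ i, (n i : ℝ)) ≠ 0 := Finset.prod_ne_zero_iff.mpr fun i _ => by exact_mod_cast (hn i).ne'
  -- assemble
  have hself : (integerStructure p k).logVolume (integerPacket p k : Set (PacketAlgebra p k)) = 0 := by
    rw [← coe_integerStructure]; exact (integerStructure p k).logVolume_self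
  have key : (integerStructure p k).logVolume (packetOf p k M : Set (PacketAlgebra p k)) /
      (finrank ℚ_[p] (PacketAlgebra p k) : ℝ) = ∑ i, (∑ j, Real.log ‖(c i j : ℚ_[p])‖) / (n i : ℝ) := by
    rw [hvol, Finset.sum_comm, hdim, Finset.sum_div]
    refine Finset.sum_congr rfl fun i _ => ?_
    have hcomb := sum_pi_apply_mul_card i (fun j => Real.log ‖(c i j : ℚ_[p])‖)
    rw [div_eq_div_iff hN0 (by exact_mod_cast (hn i).ne'), hcomb, mul_comm]
  have hrhs : ∀ i, normalizedLocalLogVolume (k i) (finrank ℚ_[p] (k i)) (M i : Set (k i)) =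
      (∑ j, Real.log ‖(c i j : ℚ_[p])‖) / (n i : ℝ) := fun i => by
    rw [normalizedLocalLogVolume_eq_div, hfac, hni]
  unfold tensorLogVolume IntegralStructure.normalizedLogVolume
  rw [hself, zero_div, zero_sub, key, Finset.sum_congr rfl fun i _ => hrhs i]
  ring

/-! ### Packets of compact open subgroups are compact open -/

/-- **`⊗_i M_i` is compact and open** for compact open subgroups `M_i ⊆ k_i` (it is a box lattice of a
tensor basis). [cite: Mochizuki2012, IUTchIV Prop. 1.2 p. 10] -/
theorem isCompact_isOpen_packetOf (M : Π i, AddSubgroup (k i)) (hMo : ∀ i, IsOpen (M i : Set (k i)))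
    (hMc : ∀ i, IsCompact (M i : Set (k i))) :
    IsCompact (packetOf p k M : Set (PacketAlgebra p k)) ∧ IsOpen (packetOf p k M : Set (PacketAlgebra p k)) := by
  choose n bZ b c hn hb hM using fun i => exists_adaptedBasis p (M i) (hMo i) (hMc i)
  let B : Basis (Π i, Fin (n i)) ℚ_[p] (PacketAlgebra p k) := Basis.piTensorProduct b
  have hpacket : (packetOf p k M : Set (PacketAlgebra p k)) =
      PadicModule.boxLattice p B (fun κ => ∏ i, c i (κ i)) := by
    rw [packetOf_eq_boxLattice p k b c M hM]
  rw [hpacket, PadicModule.coe_boxLattice]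
  exact ⟨(PadicModule.basisContinuousAddEquiv p (PacketAlgebra p k) B).toHomeomorph.isCompact_preimage.mpr
      (isCompact_univ_pi fun κ => isCompact_closedBall _ _),
    (isOpen_set_pi Set.finite_univ fun κ _ =>
      IsUltrametricDist.isOpen_closedBall _ (norm_ne_zero_iff.mpr (Units.ne_zero _))).preimage
      (PadicModule.basisContinuousAddEquiv p (PacketAlgebra p k) B).continuous⟩

/-- `0 < μ_{R_I}(⊗ M_i)` for compact open `M_i`. [cite: Mochizuki2012, IUTchIV Prop. 1.2 p. 10] -/
theorem haar_packetOf_pos (M : Π i, AddSubgroup (k i)) (hMo : ∀ i, IsOpen (M i : Set (k i)))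
    (hMc : ∀ i, IsCompact (M i : Set (k i))) :
    0 < (integerStructure p k).haar (packetOf p k M : Set (PacketAlgebra p k)) :=
  (integerStructure p k).haar_pos_of_isOpen (isCompact_isOpen_packetOf p k M hMo hMc).2
    ⟨0, (packetOf p k M).zero_mem⟩

/-- `μ_{R_I}(⊗ M_i) < ∞` for compact open `M_i`. [cite: Mochizuki2012, IUTchIV Prop. 1.2 p. 10] -/
theorem haar_packetOf_lt_top (M : Π i, AddSubgroup (k i)) (hMo : ∀ i, IsOpen (M i : Set (k i)))
    (hMc : ∀ i, IsCompact (M i : Set (k i))) :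
    (integerStructure p k).haar (packetOf p k M : Set (PacketAlgebra p k)) < ∞ :=
  (integerStructure p k).haar_lt_top_of_isCompact (isCompact_isOpen_packetOf p k M hMo hMc).1

/-- Translates `u • ⊗M_i` by a unit `u ∈ V^×` (e.g. `p^n • log_p(R_I^×)`) are compact open, hence of positive
finite volume. [cite: Mochizuki2012, IUTchIV Prop. 1.4 (iii) p. 13] -/
theorem haar_units_smul_packetOf_pos_lt_top (u : (PacketAlgebra p k)ˣ) (M : Π i, AddSubgroup (k i))
    (hMo : ∀ i, IsOpen (M i : Set (k i))) (hMc : ∀ i, IsCompact (M i : Set (k i))) :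
    0 < (integerStructure p k).haar ((u : PacketAlgebra p k) • (packetOf p k M : Set (PacketAlgebra p k))) ∧
      (integerStructure p k).haar ((u : PacketAlgebra p k) • (packetOf p k M : Set (PacketAlgebra p k))) < ∞ := by
  obtain ⟨hc, ho⟩ := isCompact_isOpen_packetOf p k M hMo hMc
  have himg : (u : PacketAlgebra p k) • (packetOf p k M : Set (PacketAlgebra p k)) =
      packetMulLeftEquiv p k u '' (packetOf p k M : Set (PacketAlgebra p k)) := by
    rw [packetMulLeftEquiv_image]; rfl
  rw [himg]
  exact ⟨(integerStructure p k).haar_pos_of_isOpen ((packetMulLeftEquiv p k u).toHomeomorph.isOpenMap _ ho)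
      ⟨_, ⟨0, (packetOf p k M).zero_mem, rfl⟩⟩,
    (integerStructure p k).haar_lt_top_of_isCompact (hc.image (packetMulLeftEquiv p k u).continuous)⟩

end Literature.IUT.LogVolume

end
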